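import Summits.BirchSwinnertonDyer.BirchSwinnertonDyer.Theorems.AdditiveWildRankOneTowerSurjOfKato
import Summits.BirchSwinnertonDyer.Rank1Residual.X11b.TwistTransportIrr
import Literature.NumberTheory.EllipticCurves.Kato2004.AdditivePotGoodRankZeroShaUpperBoundFineSelmer
import HarnessLib

/-!
# K9's residual `WildRankOne` (stmt-BirchSwinnertonDyer-19200) on ALL irreducible rows — tower onto OR NOT — in the item's
# own binders: the twist's r = 0 UPPER half on the NON-tower rows is K9's own aside `WildFineSelmerCoatesSujatha` (19386,
# Coates–Sujatha (A)) through Kato's FINE reading; so on every X4 row the LOWER half of BSD₃ is the Eisenstein ♭-inclusion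
# away from {print + K9's r = 0 items}, and BSD₃ is the ♭-IMC equality away from {print + K9's r = 0 items}

Prover seat `bsd-potss-kmc`, gen 21 (cell `bsd-potss`; row B8 «O7-ss», wild part = class O6 at `3`; K9 route
`KatoDescentPotSupersingular`, residual 19200), 2026-08-27. HONEST FRAMING: CONDITIONAL on every displayed hypothesis;
0 definitions, 0 named facts minted, 0 `sorry`; closes nothing; BSD₃ for no curve.

Gen 20 (`AdditiveWildRankOneTowerSurjOfKato.lean`) reduced 19200 on the TOWER-SURJECTIVE X4 rows to ONE analytic statement,
taking the r = 0 UPPER half of the Heegner twist `E^{(d_K)}` from Kato's A161″ (which needs `ρ_{E,3^∞}` onto); on the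
non-tower irreducible rows it left the twist's upper half as a hypothesis and flagged (memo v19 V154) that K9's U₀-ns node
19189 cannot supply it without route-level circularity (19189's Heegner road consumes the r = 1 LOWER half of twists).
This file closes that gap WITHOUT 19189: the twist `Wd` of a non-tower irreducible O6 row is again a non-tower irreducible
O6 row of analytic rank `0` (`classO6_twist_of_heegner`, `X11b.hasIrreducibleModPGaloisRep_twist_model`,
`GaloisImage.hasSurjectiveModNGaloisRep_pow_iff_of_model_twist`), so its UPPER half is EXACTLY what K9's aside
`WildFineSelmerCoatesSujatha` (item 19386: Coates–Sujatha's statement (A) at `(Wd, 3)` on the non-CM non-tower irreducible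
r = 0 O6 rows) feeds into the Literature reading
`Kato2004.rankZero_…_of_irreducible_of_fineSelmerDual_fg` (Kato 14.5 (3) with (12.5.2) replaced by «irreducible ∧ (A)»;
the K9/KT support 19387 (i)); CM twists go through the CM triple (row C8). Hence, with `hCS` := the TEXT of 19386
verbatim and `hL0` := the TEXT of 19195 verbatim (K9's route file is NOT imported — a by-name glue check is attached to
the item as evidence):

* §0 `missingUpperBoundAt_rankZero_of_irreducible_of_fineSelmerDual_fg` — route-free re-homing of k8t-c4's KT-bound
  `missingUpperBoundAt_tame_of_irreducible_of_fineSelmerDual_fg` at ANY odd additive potentially good `p`;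
* §1 `missingUpperBoundAt_twist_of_irreducible_of_fineSelmerDual_fg` — generic `p`: the Heegner twist's r = 0 UPPER half
  from (A) AT THE TWIST (twin of gen 20's `missingUpperBoundAt_twist_of_towerSurj_of_katoTam` with tower surjectivity
  replaced by irreducibility + (A));
* §2 `missingUpperBoundAt_twist_wild_of_coatesSujatha_of_kato` — `p = 3`, `ClassO6 W 3`, `ρ̄_{E,3}` irreducible, ANY
  tower: the twist's UPPER half ⟸ A161″ (tower rows) ∧ [19386's text + fine reading] (non-tower non-CM rows) ∧ CM triple;
* §3 **`missingLowerBoundAt_wildRankOne_irreducible_of_flatEisenstein_of_coatesSujatha_of_kato_of_facts`** — the r = 1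
  LOWER half of 19200 on ALL irreducible rows ⟸ X♭ (RESEARCH: SOED's crux X 20479 in ♭-currency) ∧ 19386's text ∧ A161″ ∧
  fine reading ∧ CM triple ∧ the seven cohomological facts ∧ Hsieh ∧ LZZ ∧ ToricPublishedInputs;
  **`bsdp_wildRankOne_irreducible_of_flatIMCEq_of_coatesSujatha_of_wildLowerHalfRankZero_of_kato_of_facts`** — `BSD₃`
  on ALL irreducible r = 1 O6 rows ⟸ IMC♭-eq (RESEARCH) ∧ 19386's text ∧ 19195's text ∧ the same print (the
  `MissingPPartAt W 3` currency of 19200 and the KT twin are in the sequel file `AdditiveTameRankOneNonTowerOfConjA.lean`).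

NET for the K9 tenure: on the X4 (irreducible) wild rank-one rows — 5 348 S-b pairs, tower onto or not — 19200 ⟸ ONE
analytic statement (IMC♭-eq at the wild 3; X♭ for the lower half) + K9's OWN r = 0 items L₀ (19195) and (A) (19386, only
at the non-tower twists) + named print. The U₀-ns node 19189 and its Jetchev roads are NOT used (no circularity).

References: [Kato2004Asterisque] Thm. 12.5 (3), 13.14, Thm. 14.5 (3), 14.14, Prop. 14.16 (2); [Lim2017FineSelmer] §3;
[CoatesSujatha2005] §3; [GrossZagier1986] I.(6.3), Thm. I.7.3; [JetchevSkinnerWan2017] §7.4.1, Thm. 3.3.1; [Hsieh2014]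
Thm A; [LiuZhangZhang2018] Thm 1.5.1/1.5.3; [BurungaleFlach2024] Thm. 1.1, Cor. 2; [Serre1967GroupesPDivisibles] §5 Prop. 8;
[SilvermanATAEC1994] IV.9.4; [Mazur1978] §5.
-/

noncomputable section

open scoped Classical

set_option linter.dupNamespace false
set_option autoImplicit false

namespace Summit.BirchSwinnertonDyer.BirchSwinnertonDyer.Theorems.UniversalToricDescentWaldspurgerFlat

open WeierstrassCurve NumberField IsDedekindDomain Field PowerSeries
  Literature.NumberTheory.EllipticCurves
  Literature.NumberTheory.EllipticCurves.ModularForms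
  Literature.NumberTheory.EllipticCurves.Rank1Residual
  Literature.NumberTheory.EllipticCurves.Rank1Residual.Typed
  Literature.NumberTheory.EllipticCurves.KrizLi2019
  Literature.NumberTheory.GaloisRepresentations
  Literature.NumberTheory.GaloisCohomology
  Summit.BirchSwinnertonDyer.Rank1Residual
  Summit.BirchSwinnertonDyer.Rank1Residual.Additive
  Summit.BirchSwinnertonDyer.Rank1Residual.X11b
  Summit.BirchSwinnertonDyer.Rank1Residual.X11b.AcSelmer
  Summit.BirchSwinnertonDyer.Rank1Residual.X11b.Halves
  Summit.BirchSwinnertonDyer.Rank1Residual.X11b.CongruenceLimit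
  Summit.BirchSwinnertonDyer.BirchSwinnertonDyer.Theses.UniversalToricDescent
  Summit.BirchSwinnertonDyer.BirchSwinnertonDyer.Theorems.AdditivePotSupersingularControl

/-! ## §0 The r = 0 UPPER half from Coates–Sujatha (A) through Kato's fine reading — route-free, any odd additive pot-good `p` -/

/-- CM rank-zero rows: the UPPER half from the CM triple (Rubin / Burungale–Flach, row C8), any prime.
[cite: BurungaleFlach2024, Thm. 1.1 and Cor. 2 (p. 4)] -/
private theorem missingUpperBoundAt_of_hasCM_rankZero' (hCM : bsdTriple_of_hasCM_of_L_one_ne_zero)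
    (hmod : hasEntireLFunction_rat) (hGZK : rank_eq_analyticRank_of_analyticRank_le_one)
    (W : WeierstrassCurve ℚ) [W.IsElliptic] [W.IsGloballyMinimal] (p : ℕ) [Fact p.Prime]
    (hr : W.analyticRank = 0) (hcm : W.HasCM) : MissingUpperBoundAt W p := by
  haveI : Finite W.sha := (hGZK W (by omega)).2
  exact (lower_and_upper_of_missingPPartAt W p (missingPPartAt_of_bsdp W p (bsdp_cm_rankZero hCM hmod hcm hr))).2

/-- **The r = 0 UPPER half `ord_p #Ш ≤ ord_p #Ш_an` from the finite generation of `Y(E/ℚ^cyc)` over `ℤ_p` (Coates–Sujatha's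
statement (A) at `(E,p)`) through Kato's FINE reading**, at ANY odd additive potentially good `p` with `E[p]` irreducible
(route-free re-homing of k8t-c4's `missingUpperBoundAt_tame_of_irreducible_of_fineSelmerDual_fg`, whose module imports the KT
route file; the (t′) binder there is used only for `ord_p j ≥ 0`, displayed here). The reading bounds `ord_p #Ш + v_p(∏c_ℓ)`
by `ord_p(L/Ω)`; `#Ш_an = (L/Ω)·#tors²/∏c_ℓ`; the torsion term vanishes by irreducibility. CONDITIONAL on the reading `hKatoA`
and on `hA`. [cite: Kato2004Asterisque, Thm. 14.5 (3) (p. 236), Thm. 12.5 (3) (p. 222), 14.14 (p. 243), Prop. 14.16 (2) (p. 244)]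
[cite: Lim2017FineSelmer, §3] [cite: Miller2011LMS, Def. 1.1] -/
theorem missingUpperBoundAt_rankZero_of_irreducible_of_fineSelmerDual_fg (p : ℕ) [Fact p.Prime] (hp2 : p ≠ 2)
    (hKatoA :
      Kato2004.rankZero_padicValNat_sha_add_padicValNat_tamagawa_le_of_additive_potGood_of_irreducible_of_fineSelmerDual_fg)
    (hGZK : rank_eq_analyticRank_of_analyticRank_le_one) (hmod : hasEntireLFunction_rat)
    (W : WeierstrassCurve ℚ) [W.IsElliptic] [W.IsGloballyMinimal] (hr : W.analyticRank = 0) (haddv : Addv W p)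
    (hj : 0 ≤ padicValRat p W.j) (hirr : W.HasIrreducibleModPGaloisRep p)
    (hA : ∀ (κ : ZpExtension ℚ p), κ.IsCyclotomic →
      ∃ (γ : Field.absoluteGaloisGroup ℚ) (D : W.FineSelmerDualData κ γ),
        Module.Finite ℤ_[p] (RestrictScalars ℤ_[p] (IwasawaAlgebra p) D.X)) :
    MissingUpperBoundAt W p := by
  have hL : W.entireLFunction 1 ≠ 0 := (W.analyticRank_eq_zero_iff_holds (hmod W)).mp hr
  obtain ⟨hmw, hfin⟩ := hGZK W (by rw [hr]; exact zero_le_one)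
  haveI : Finite W.sha := hfin
  have hmw0 : W.mordellWeilRank = 0 := by rw [hmw, hr]
  obtain ⟨q₀, hq₀, hle⟩ := hKatoA W p hp2 haddv.1 haddv.2 hj hirr hA hL hfin
  have hΩpos : 0 < W.realPeriodRat := W.realPeriodRat_pos_holds
  have hΩ : (W.realPeriodRat : ℂ) ≠ 0 := by exact_mod_cast hΩpos.ne'
  have hc0 : 0 < W.tamagawaProduct := W.tamagawaProduct_pos_holds
  have ht0 : 0 < W.torsionOrder := W.torsionOrder_pos_holds
  have hq₀0 : q₀ ≠ 0 := by
    rintro rfl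
    rw [Rat.cast_zero, div_eq_zero_iff] at hq₀
    exact hq₀.elim hL hΩ
  have ht : (W.torsionOrder : ℚ) ≠ 0 := by exact_mod_cast ht0.ne'
  have hcq : (W.tamagawaProduct : ℚ) ≠ 0 := by exact_mod_cast hc0.ne'
  have hsha : padicValNat p (Nat.card (AddCommGroup.primaryComponent W.sha p)) = padicValNat p W.shaOrder := by
    unfold WeierstrassCurve.shaOrder
    exact padicValNat_card_addPrimaryComponent p
  have htors : padicValNat p W.torsionOrder = 0 := padicValNat_torsionOrder_eq_zero_of_irreducible W p hirr
  refine ⟨q₀ * (W.torsionOrder : ℚ) ^ 2 / (W.tamagawaProduct : ℚ), ?_, ?_⟩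
  · have hLq : W.entireLFunction 1 = (q₀ : ℂ) * (W.realPeriodRat : ℂ) := by
      rw [← hq₀, div_mul_cancel₀ _ hΩ]
    rw [shaAn_def, WeierstrassCurve.leadingLCoeff_eq_of_analyticRank_eq_zero W hr, W.regulator_eq_one_of_rank_zero hmw0,
      hLq]
    push_cast
    field_simp
  · have hv : padicValRat p (q₀ * (W.torsionOrder : ℚ) ^ 2 / (W.tamagawaProduct : ℚ)) =
        padicValRat p q₀ + 2 * (padicValNat p W.torsionOrder : ℤ) - (padicValNat p W.tamagawaProduct : ℤ) := by
      rw [padicValRat.div (mul_ne_zero hq₀0 (pow_ne_zero 2 ht)) hcq, padicValRat.mul hq₀0 (pow_ne_zero 2 ht), pow_two,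
        padicValRat.mul ht ht, padicValRat.of_nat, padicValRat.of_nat]
      ring
    rw [hv, ← hsha, htors]
    simp only [Nat.cast_zero, mul_zero, add_zero]
    linarith

/-! ## §1 The Heegner twist's r = 0 UPPER half from (A) AT THE TWIST — generic odd additive pot-good `p`, irreducible image -/

/-- **The twist's r = 0 UPPER half from Coates–Sujatha (A) at the twist**, twin of gen 20's
`missingUpperBoundAt_twist_of_towerSurj_of_katoTam` with `ρ_{E,p^∞}` onto REPLACED by «`ρ̄_{E,p}` irreducible ∧ `Y(Wd/ℚ^cyc)`
finitely generated over `ℤ_p`»: for `W` globally minimal, additive at the odd `p` with `ord_p j ≥ 0` and `E[p]` irreducible,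
`K` a Heegner field for `N_E`, `Wd` a globally minimal model of `E^{(d_K)}` with `L(E^{(d_K)},1) ≠ 0`: `Addv`, `j` and the
irreducibility transport along the `p`-adic-square twist (`AdditivePotMult.addv_iff_of_twist`, `j_of_model_twist`,
`X11b.hasIrreducibleModPGaloisRep_twist_model`), `r_an(Wd) = 0`, and §0 applies at `(Wd, p)`. CONDITIONAL on `hKatoA`, `hA`.
[cite: Kato2004Asterisque, Thm. 14.5 (3) (p. 236), Prop. 14.16 (2) (p. 244)] [cite: Lim2017FineSelmer, §3]
[cite: Mazur1978, §5 (twist invariance of irreducibility)] -/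
theorem missingUpperBoundAt_twist_of_irreducible_of_fineSelmerDual_fg (p : ℕ) [Fact p.Prime] (hp2 : p ≠ 2)
    (hKatoA :
      Kato2004.rankZero_padicValNat_sha_add_padicValNat_tamagawa_le_of_additive_potGood_of_irreducible_of_fineSelmerDual_fg)
    (hGZK : rank_eq_analyticRank_of_analyticRank_le_one) (hmod : hasEntireLFunction_rat)
    (W : WeierstrassCurve ℚ) [W.IsElliptic] [W.IsGloballyMinimal] (haddv : Addv W p) (hj : 0 ≤ padicValRat p W.j)
    (hirr : W.HasIrreducibleModPGaloisRep p)
    {N : ℕ} (hN : W.conductorNorm ℤ = N) (K : Type) [Field K] [NumberField K] (hK : IsImaginaryQuadratic K)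
    (hHN : SatisfiesHeegnerHypothesis N K) (Wd : WeierstrassCurve ℚ) [Wd.IsElliptic] [Wd.IsGloballyMinimal]
    (hWd : ∃ C : VariableChange ℚ, C • W.quadraticTwist (NumberField.discr K : ℚ) = Wd)
    (hLd : (W.quadraticTwist (NumberField.discr K : ℚ)).entireLFunction 1 ≠ 0)
    (hA : ∀ (κ : ZpExtension ℚ p), κ.IsCyclotomic →
      ∃ (γ : Field.absoluteGaloisGroup ℚ) (D : Wd.FineSelmerDualData κ γ),
        Module.Finite ℤ_[p] (RestrictScalars ℤ_[p] (IwasawaAlgebra p) D.X)) : MissingUpperBoundAt Wd p := by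
  have hp : p.Prime := Fact.out
  have hD0 : (NumberField.discr K : ℚ) ≠ 0 := by exact_mod_cast NumberField.discr_ne_zero K
  haveI : (W.quadraticTwist (NumberField.discr K : ℚ)).IsElliptic := W.isElliptic_quadraticTwist hD0
  obtain ⟨Cd, hCd⟩ := hWd
  have hpN : p ∣ N := by
    rw [← hN]; exact (W.dvd_conductorNorm_iff_not_hasGoodReductionAtPrime p).mpr (not_good_of_addv W p haddv)
  have hsq' : IsSquare (algebraMap ℚ ℚ_[p] (NumberField.discr K : ℚ)) :=
    X11b.isSquare_discr_padic_of_heegner K hK hHN p hpN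
  have hsq : IsSquare (((NumberField.discr K : ℚ) : ℚ) : ℚ_[p]) := by simpa using hsq'
  have haddvd : Addv Wd p := (AdditivePotMult.addv_iff_of_twist (W := W) hD0 hsq Wd hCd).mpr haddv
  have hjd : Wd.j = W.j := AdditivePotMult.j_of_model_twist (W := W) hD0 ⟨Cd, hCd⟩
  have hirrd : Wd.HasIrreducibleModPGaloisRep p := X11b.hasIrreducibleModPGaloisRep_twist_model W p K hK.1 hirr Cd hCd
  have hLd1 : Wd.entireLFunction 1 ≠ 0 := by rw [← hCd, entireLFunction_smul]; exact hLd
  have hrd : Wd.analyticRank = 0 := analyticRank_eq_zero_of_entireLFunction_one_ne_zero Wd hLd1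
  exact missingUpperBoundAt_rankZero_of_irreducible_of_fineSelmerDual_fg p hp2 hKatoA hGZK hmod Wd hrd haddvd
    (by rw [hjd]; exact hj) hirrd hA

section WildThree

variable [Fact (3 : ℕ).Prime] (R : WeierstrassCurve ℚ → Prop)

/-! ## §2 The twist's UPPER half on ALL irreducible wild rows: A161″ (tower) ∨ 19386's text (non-tower, non-CM) ∨ CM triple -/

/-- **The Heegner twist's r = 0 UPPER half on EVERY irreducible O6 row, tower onto or not.** For `W` globally minimal with
`ClassO6 W 3` and `ρ̄_{E,3}` irreducible, `K` a Heegner field for `N_E` with ODD discriminant, `Wd` a globally minimal model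
of `E^{(d_K)}` with `L(E^{(d_K)},1) ≠ 0`: `MissingUpperBoundAt Wd 3` ⟸ Kato's A161″ `hKatoT` (used when `ρ_{E,3^n}` is onto
for all `n`) ∧ the fine reading `hKatoA` + `hCS` = the TEXT of K9's aside `WildFineSelmerCoatesSujatha` (item 19386) VERBATIM
(used when the tower is not onto and `Wd` is non-CM: `Wd` is again O6, irreducible, non-tower, `r_an = 0` —
`classO6_twist_of_heegner`, `hasIrreducibleModPGaloisRep_twist_model`, `hasSurjectiveModNGaloisRep_pow_iff_of_model_twist`)
∧ the CM triple `hCM` (CM twists). CONDITIONAL; nothing about (A), A161″ or the reading is asserted.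
[cite: Kato2004Asterisque, Thm. 14.5 (3) (p. 236), Prop. 14.16 (2) (p. 244)] [cite: CoatesSujatha2005, §3 (Conjecture A)]
[cite: SilvermanATAEC1994, IV.9.4 (PDF pp. 344–346)] [cite: BurungaleFlach2024, Thm. 1.1 and Cor. 2 (p. 4)] -/
theorem missingUpperBoundAt_twist_wild_of_coatesSujatha_of_kato
    (hKatoT : Kato2004.rankZero_padicValNat_sha_add_padicValNat_tamagawa_le_of_additive_potGood_of_imageContainsSL2)
    (hKatoA :
      Kato2004.rankZero_padicValNat_sha_add_padicValNat_tamagawa_le_of_additive_potGood_of_irreducible_of_fineSelmerDual_fg)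
    (hCM : bsdTriple_of_hasCM_of_L_one_ne_zero)
    (hGZK : rank_eq_analyticRank_of_analyticRank_le_one) (hmod : hasEntireLFunction_rat)
    (hCS : ∀ (W : WeierstrassCurve ℚ) [W.IsElliptic] [W.IsGloballyMinimal] [Fact (3 : ℕ).Prime], W.analyticRank = 0 →
      ClassO6 W 3 → W.HasIrreducibleModPGaloisRep 3 → ¬ (∀ n : ℕ, W.HasSurjectiveModNGaloisRep (3 ^ n : ℕ)) → ¬ W.HasCM →
      ∀ (κ : ZpExtension ℚ 3), κ.IsCyclotomic → ∃ (γ : Field.absoluteGaloisGroup ℚ) (D : W.FineSelmerDualData κ γ),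
        Module.Finite ℤ_[3] (RestrictScalars ℤ_[3] (IwasawaAlgebra 3) D.X))
    (W : WeierstrassCurve ℚ) [W.IsElliptic] [W.IsGloballyMinimal] (hO6 : ClassO6 W 3) (hirr : W.HasIrreducibleModPGaloisRep 3)
    {N : ℕ} (hN : W.conductorNorm ℤ = N) (K : Type) [Field K] [NumberField K] (hK : IsImaginaryQuadratic K)
    (hHN : SatisfiesHeegnerHypothesis N K) (hodd : Odd (NumberField.discr K))
    (Wd : WeierstrassCurve ℚ) [Wd.IsElliptic] [Wd.IsGloballyMinimal]
    (hWd : ∃ C : VariableChange ℚ, C • W.quadraticTwist (NumberField.discr K : ℚ) = Wd)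
    (hLd : (W.quadraticTwist (NumberField.discr K : ℚ)).entireLFunction 1 ≠ 0) : MissingUpperBoundAt Wd 3 := by
  have haddv : Addv W 3 := hO6.2.1
  have hj : 0 ≤ padicValRat 3 W.j := hO6.padicValRat_j_nonneg
  by_cases hsurj : ∀ n : ℕ, W.HasSurjectiveModNGaloisRep (3 ^ n : ℕ)
  · exact missingUpperBoundAt_twist_of_towerSurj_of_katoTam 3 (by decide) hKatoT hGZK hmod W haddv hj hsurj hN K hK hHN Wd
      hWd hLd
  · have hD0 : (NumberField.discr K : ℚ) ≠ 0 := by exact_mod_cast NumberField.discr_ne_zero K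
    haveI : (W.quadraticTwist (NumberField.discr K : ℚ)).IsElliptic := W.isElliptic_quadraticTwist hD0
    obtain ⟨Cd, hCd⟩ := hWd
    have hLd1 : Wd.entireLFunction 1 ≠ 0 := by rw [← hCd, entireLFunction_smul]; exact hLd
    have hrd : Wd.analyticRank = 0 := analyticRank_eq_zero_of_entireLFunction_one_ne_zero Wd hLd1
    by_cases hcm : Wd.HasCM
    · exact missingUpperBoundAt_of_hasCM_rankZero' hCM hmod hGZK Wd 3 hrd hcm
    · have hHN' : SatisfiesHeegnerHypothesis (W.conductorNorm ℤ) K := hN ▸ hHN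
      obtain ⟨hO6d, -⟩ := classO6_twist_of_heegner W hO6 K hK hHN' hodd Wd Cd hCd
      have hirrd : Wd.HasIrreducibleModPGaloisRep 3 := X11b.hasIrreducibleModPGaloisRep_twist_model W 3 K hK.1 hirr Cd hCd
      have hnsd : ¬ (∀ n : ℕ, Wd.HasSurjectiveModNGaloisRep (3 ^ n : ℕ)) := fun h ↦
        hsurj fun n ↦ (GaloisImage.hasSurjectiveModNGaloisRep_pow_iff_of_model_twist W 3 hD0 ⟨Cd, hCd⟩ n).mp (h n)
      exact missingUpperBoundAt_twist_of_irreducible_of_fineSelmerDual_fg 3 (by decide) hKatoA hGZK hmod W haddv hj hirr hN K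
        hK hHN Wd ⟨Cd, hCd⟩ hLd (hCS Wd hrd hO6d hirrd hnsd hcm)

/-! ## §3 K9's residual 19200 on ALL irreducible rows, in the item's own binders -/

/-- **The LOWER half of K9's `WildRankOne` on ALL irreducible rows from the Eisenstein ♭-inclusion (modulo print + K9's own
aside 19386).** For any row predicate `R`, on `r_an = 1`, `ClassO6 W 3`, `ρ̄_{E,3}` irreducible, `R W`:
`MissingLowerBoundAt W 3` ⟸ `hIncl` (X on the class rows — RESEARCH; at the wild `3` route SOED's crux X in ♭-currency) ∧
`hCS` (the TEXT of 19386 `WildFineSelmerCoatesSujatha`: (A) on the non-CM non-tower irreducible r = 0 O6 rows — consumed at the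
non-tower twists only) ∧ A161″ ∧ the fine reading ∧ the CM triple ∧ {Poitou–Tate ×2, local Euler–Poincaré, cd ≤ 2, Brink
Thm 2 / Cor 1, Serre 1967} ∧ Hsieh ∧ LZZ ∧ ToricPublishedInputs. Control: `additiveControl_heegner_potSS_of_facts_of_serre1967`;
index socket: `indexLowerBoundLeAt_of_flatInclLe_of_control`; halves: `missingLowerBoundAt_of_indexLower_of_twistUpperOdd_row`;
the twist's UPPER half: §2. CONDITIONAL; closes nothing; BSD₃ for no curve.
[cite: JetchevSkinnerWan2017, §7.4.1 and Thm. 3.3.1 (arXiv:1512.06894)] [cite: Kato2004Asterisque, Thm. 14.5 (3), Prop. 14.16 (2)]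
[cite: CoatesSujatha2005, §3 (Conjecture A)] [cite: Serre1967GroupesPDivisibles, §5 Prop. 8] [cite: GrossZagier1986, I.(6.3)] -/
theorem missingLowerBoundAt_wildRankOne_irreducible_of_flatEisenstein_of_coatesSujatha_of_kato_of_facts
    (hA : Hsieh2014.thmA_exists_isHsiehLFunction_unrPeriod_anyLevel)
    (hL : LiuZhangZhang2018.thm151_thm153_modularCurve_heegnerVector_additive)
    (hF : ToricPublishedInputs)
    (hKatoT : Kato2004.rankZero_padicValNat_sha_add_padicValNat_tamagawa_le_of_additive_potGood_of_imageContainsSL2)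
    (hKatoA :
      Kato2004.rankZero_padicValNat_sha_add_padicValNat_tamagawa_le_of_additive_potGood_of_irreducible_of_fineSelmerDual_fg)
    (hCM : bsdTriple_of_hasCM_of_L_one_ne_zero)
    (hPT : ∀ (K : Type) [Field K] [NumberField K], poitouTate_selmerStructure_duality K)
    (hPT2 : ∀ (K : Type) [Field K] [NumberField K], poitouTate_sha_tateDual K)
    (hEP : ∀ (K : Type) [Field K] [NumberField K] (v : HeightOneSpectrum (𝓞 K)),
      localEulerPoincareCharacteristic (v.adicCompletion K))
    (hcd : fieldCdLE_two_of_numberField)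
    (hBr : ∀ (K : Type) [Field K] [NumberField K] (p : ℕ) [Fact p.Prime],
      ZpExtension.decomp_not_le_kerSubgroup_of_isAnticyclotomic K p)
    (hBr2 : ∀ (K : Type) [Field K] [NumberField K] (p : ℕ) [Fact p.Prime],
      ZpExtension.decomp_not_le_kerSubgroup_above_of_isAnticyclotomic K p)
    (hS : Serre1967.noStableDivisibleLine_of_potentiallySupersingular)
    (hCS : ∀ (W : WeierstrassCurve ℚ) [W.IsElliptic] [W.IsGloballyMinimal] [Fact (3 : ℕ).Prime], W.analyticRank = 0 →
      ClassO6 W 3 → W.HasIrreducibleModPGaloisRep 3 → ¬ (∀ n : ℕ, W.HasSurjectiveModNGaloisRep (3 ^ n : ℕ)) → ¬ W.HasCM →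
      ∀ (κ : ZpExtension ℚ 3), κ.IsCyclotomic → ∃ (γ : Field.absoluteGaloisGroup ℚ) (D : W.FineSelmerDualData κ γ),
        Module.Finite ℤ_[3] (RestrictScalars ℤ_[3] (IwasawaAlgebra 3) D.X))
    (hIncl : ∀ (W : WeierstrassCurve ℚ) [W.IsElliptic] [W.IsGloballyMinimal] (N : ℕ) [NeZero N] (K : Type) [Field K]
      [NumberField K] (Dt : ModularParametrizationData W N),
      R W → ClassO6 W 3 → W.HasIrreducibleModPGaloisRep 3 → W.analyticRank = 1 →
      W.conductorNorm ℤ = N → IsImaginaryQuadratic K → SatisfiesHeegnerHypothesis N K →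
      ∀ (κ : ZpExtension K 3), κ.IsAnticyclotomic → ∀ (γ : Field.absoluteGaloisGroup K) [Fact (κ.IsTopGenerator γ)]
        (𝔭 : HeightOneSpectrum (𝓞 K)), ((3 : ℕ) : 𝓞 K) ∈ 𝔭.asIdeal → 𝔭.asIdeal.ramificationIdx (𝓞 ℚ) = 1 →
        𝔭.asIdeal.inertiaDeg (𝓞 ℚ) = 1 → ∀ (𝔭' : HeightOneSpectrum (𝓞 K)), ((3 : ℕ) : 𝓞 K) ∈ 𝔭'.asIdeal → 𝔭' ≠ 𝔭 →
        ∀ (ι' : PadicAlgCl 3 ≃+* ℂ), SchneiderFree.BranchInducesPrime 3 ι' 𝔭 →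
        ∀ (ΩK : ℂ) (Ωp : ℂ_[3]) (Q : PowerSeries (PadicComplexInt 3)), ΩK ≠ 0 → Ωp ≠ 0 →
          R1.IsBDPLFunctionInt 3 ι' 𝔭 κ γ Dt.f ΩK Ωp Q →
          (XAc.charIdeal (W.baseChange K) 3 κ 𝔭' ∅ γ).map (PowerSeries.map (R1.toCpInt 3)) ≤ Ideal.span {Q}) :
    ∀ (W : WeierstrassCurve ℚ) [W.IsElliptic] [W.IsGloballyMinimal], W.analyticRank = 1 → ClassO6 W 3 →
      W.HasIrreducibleModPGaloisRep 3 → R W → MissingLowerBoundAt W 3 := by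
  intro W _ _ hr hO6 hirr hR
  have haddv : Addv W 3 := hO6.2.1
  have hGZK : rank_eq_analyticRank_of_analyticRank_le_one := hF.2.2.1
  have hmod : hasEntireLFunction_rat := hF.2.2.2.1
  have hKo : ∀ (N : ℕ) [NeZero N] (W : WeierstrassCurve ℚ) (K : Type) [Field K] [NumberField K],
      Literature.NumberTheory.EllipticCurves.kolyvagin N W K := hF.2.1
  refine missingLowerBoundAt_of_indexLower_of_twistUpperOdd_row 3 (by decide) hF W haddv hr ?_ ?_
  · intro N _ K _ _ Dt H ι P hN hK hHN _hodd hd4 _hLt hP hnt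
    exact indexLowerBoundLeAt_of_flatInclLe_of_control (by decide) hA hL Dt H ι P haddv hN hK hHN hd4 hP hnt (hKo N W K)
      (fun κ hκ γ _ 𝔭 h𝔭 he hf 𝔭' h𝔭' hne ι' hind ΩK Ωp Q hΩK hΩp hBDP ↦
        hIncl W N K Dt hR hO6 hirr hr hN hK hHN κ hκ γ 𝔭 h𝔭 he hf 𝔭' h𝔭' hne ι' hind ΩK Ωp Q hΩK hΩp hBDP)
      (fun κ hκ γ _ 𝔭 h𝔭 he hf ↦
        additiveControl_heegner_potSS_of_facts_of_serre1967 hPT hPT2 hEP hcd hBr hBr2 hS 3 W N K Dt H ι P (Or.inr hO6) hirr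
          hN hK hHN hP hnt (hKo N W K) κ hκ γ 𝔭 h𝔭 he hf)
  · intro N _ K _ _ Wd _ _ hN hK hHN hodd _hd4 hC hLt
    exact missingUpperBoundAt_twist_wild_of_coatesSujatha_of_kato hKatoT hKatoA hCM hGZK hmod hCS W hO6 hirr hN K hK hHN hodd
      Wd hC hLt

/-- **K9's `WildRankOne` on ALL irreducible rows from the ♭-IMC equality, `WildFineSelmerCoatesSujatha` (19386) and
`WildLowerHalfRankZero` (19195), modulo print.** For any row predicate `R`, on `r_an = 1`, `ClassO6 W 3`, `ρ̄_{E,3}` irreducible,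
`R W`: `BSDp W 3` ⟸ `hEq` (the ♭-(∅,0)-IMC equality on the class rows — RESEARCH) ∧ `hCS` (19386's text, at the non-tower
twists) ∧ `hL0` (19195's text `∀ W, r_an = 0 → ClassO6 W 3 → MissingLowerBoundAt W 3`, at the twists — RESEARCH) ∧ A161″ ∧
the fine reading ∧ the CM triple ∧ the seven cohomological facts ∧ Hsieh ∧ LZZ ∧ ToricPublishedInputs. K9's route file is not
imported (texts verbatim). The U₀-ns node 19189 is NOT used. CONDITIONAL; closes nothing; BSD₃ for no curve.
[cite: JetchevSkinnerWan2017, §7.4.1 and Thm. 3.3.1 (arXiv:1512.06894)] [cite: Kato2004Asterisque, Thm. 14.5 (3), Prop. 14.16 (2)]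
[cite: CoatesSujatha2005, §3 (Conjecture A)] [cite: SilvermanATAEC1994, IV.9.4 (PDF pp. 344–346)]
[cite: Serre1967GroupesPDivisibles, §5 Prop. 8] [cite: GrossZagier1986, I.(6.3) and Thm. I.7.3] -/
theorem bsdp_wildRankOne_irreducible_of_flatIMCEq_of_coatesSujatha_of_wildLowerHalfRankZero_of_kato_of_facts
    (hA : Hsieh2014.thmA_exists_isHsiehLFunction_unrPeriod_anyLevel)
    (hL : LiuZhangZhang2018.thm151_thm153_modularCurve_heegnerVector_additive)
    (hF : ToricPublishedInputs)
    (hKatoT : Kato2004.rankZero_padicValNat_sha_add_padicValNat_tamagawa_le_of_additive_potGood_of_imageContainsSL2)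
    (hKatoA :
      Kato2004.rankZero_padicValNat_sha_add_padicValNat_tamagawa_le_of_additive_potGood_of_irreducible_of_fineSelmerDual_fg)
    (hCM : bsdTriple_of_hasCM_of_L_one_ne_zero)
    (hPT : ∀ (K : Type) [Field K] [NumberField K], poitouTate_selmerStructure_duality K)
    (hPT2 : ∀ (K : Type) [Field K] [NumberField K], poitouTate_sha_tateDual K)
    (hEP : ∀ (K : Type) [Field K] [NumberField K] (v : HeightOneSpectrum (𝓞 K)),
      localEulerPoincareCharacteristic (v.adicCompletion K))
    (hcd : fieldCdLE_two_of_numberField)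
    (hBr : ∀ (K : Type) [Field K] [NumberField K] (p : ℕ) [Fact p.Prime],
      ZpExtension.decomp_not_le_kerSubgroup_of_isAnticyclotomic K p)
    (hBr2 : ∀ (K : Type) [Field K] [NumberField K] (p : ℕ) [Fact p.Prime],
      ZpExtension.decomp_not_le_kerSubgroup_above_of_isAnticyclotomic K p)
    (hS : Serre1967.noStableDivisibleLine_of_potentiallySupersingular)
    (hCS : ∀ (W : WeierstrassCurve ℚ) [W.IsElliptic] [W.IsGloballyMinimal] [Fact (3 : ℕ).Prime], W.analyticRank = 0 →
      ClassO6 W 3 → W.HasIrreducibleModPGaloisRep 3 → ¬ (∀ n : ℕ, W.HasSurjectiveModNGaloisRep (3 ^ n : ℕ)) → ¬ W.HasCM →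
      ∀ (κ : ZpExtension ℚ 3), κ.IsCyclotomic → ∃ (γ : Field.absoluteGaloisGroup ℚ) (D : W.FineSelmerDualData κ γ),
        Module.Finite ℤ_[3] (RestrictScalars ℤ_[3] (IwasawaAlgebra 3) D.X))
    (hEq : ∀ (W : WeierstrassCurve ℚ) [W.IsElliptic] [W.IsGloballyMinimal] (N : ℕ) [NeZero N] (K : Type) [Field K]
      [NumberField K] (Dt : ModularParametrizationData W N),
      R W → ClassO6 W 3 → W.HasIrreducibleModPGaloisRep 3 → W.analyticRank = 1 →
      W.conductorNorm ℤ = N → IsImaginaryQuadratic K → SatisfiesHeegnerHypothesis N K →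
      ∀ (κ : ZpExtension K 3), κ.IsAnticyclotomic → ∀ (γ : Field.absoluteGaloisGroup K) [Fact (κ.IsTopGenerator γ)]
        (𝔭 : HeightOneSpectrum (𝓞 K)), ((3 : ℕ) : 𝓞 K) ∈ 𝔭.asIdeal → 𝔭.asIdeal.ramificationIdx (𝓞 ℚ) = 1 →
        𝔭.asIdeal.inertiaDeg (𝓞 ℚ) = 1 → ∀ (𝔭' : HeightOneSpectrum (𝓞 K)), ((3 : ℕ) : 𝓞 K) ∈ 𝔭'.asIdeal → 𝔭' ≠ 𝔭 →
        ∀ (ι' : PadicAlgCl 3 ≃+* ℂ), SchneiderFree.BranchInducesPrime 3 ι' 𝔭 →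
        ∀ (ΩK : ℂ) (Ωp : ℂ_[3]) (Q : PowerSeries (PadicComplexInt 3)), ΩK ≠ 0 → Ωp ≠ 0 →
          R1.IsBDPLFunctionInt 3 ι' 𝔭 κ γ Dt.f ΩK Ωp Q →
          (XAc.charIdeal (W.baseChange K) 3 κ 𝔭' ∅ γ).map (PowerSeries.map (R1.toCpInt 3)) = Ideal.span {Q})
    (hL0 : ∀ (W : WeierstrassCurve ℚ) [W.IsElliptic] [W.IsGloballyMinimal] [Fact (3 : ℕ).Prime], W.analyticRank = 0 →
      ClassO6 W 3 → MissingLowerBoundAt W 3) :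
    ∀ (W : WeierstrassCurve ℚ) [W.IsElliptic] [W.IsGloballyMinimal], W.analyticRank = 1 → ClassO6 W 3 →
      W.HasIrreducibleModPGaloisRep 3 → R W → BSDp W 3 := by
  intro W _ _ hr hO6 hirr hR
  have haddv : Addv W 3 := hO6.2.1
  have hGZK : rank_eq_analyticRank_of_analyticRank_le_one := hF.2.2.1
  have hmod : hasEntireLFunction_rat := hF.2.2.2.1
  have hKo : ∀ (N : ℕ) [NeZero N] (W : WeierstrassCurve ℚ) (K : Type) [Field K] [NumberField K],
      Literature.NumberTheory.EllipticCurves.kolyvagin N W K := hF.2.1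
  have hCtl : ∀ (N : ℕ) [NeZero N] (K : Type) [Field K] [NumberField K] (Dt : ModularParametrizationData W N)
      (H : HeegnerDatum N (NumberField.discr K)) (ι : K →+* ℂ) (P : (W.baseChange K).toAffine.Point),
      W.conductorNorm ℤ = N → IsImaginaryQuadratic K → SatisfiesHeegnerHypothesis N K →
      WeierstrassCurve.Affine.Point.map ι.toRatAlgHom P = heegnerPointComplex Dt H → ¬ IsOfFinAddOrder P →
      Literature.NumberTheory.EllipticCurves.kolyvagin N W K →
      ∀ (κ : ZpExtension K 3), κ.IsAnticyclotomic → ∀ (γ : Field.absoluteGaloisGroup K) [Fact (κ.IsTopGenerator γ)]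
        (𝔭 : HeightOneSpectrum (𝓞 K)) (h𝔭 : ((3 : ℕ) : 𝓞 K) ∈ 𝔭.asIdeal) (he : 𝔭.asIdeal.ramificationIdx (𝓞 ℚ) = 1)
        (hf : 𝔭.asIdeal.inertiaDeg (𝓞 ℚ) = 1), SchneiderFree.AdditiveControlOnTreeAt 3 κ 𝔭 γ (embAt K 3 𝔭 h𝔭 he hf) P :=
    fun N _ K _ _ Dt H ι P hN hK hHN hP hnt hKo' κ hκ γ _ 𝔭 h𝔭 he hf ↦
      additiveControl_heegner_potSS_of_facts_of_serre1967 hPT hPT2 hEP hcd hBr hBr2 hS 3 W N K Dt H ι P (Or.inr hO6) hirr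
        hN hK hHN hP hnt hKo' κ hκ γ 𝔭 h𝔭 he hf
  refine bsdp_of_indexHalves_of_twistHalvesOdd_row 3 (by decide) hF W haddv hr ?_ ?_ ?_ ?_
  · intro N _ K _ _ Dt H ι P hN hK hHN _hodd hd4 _hLt hP hnt
    exact indexLowerBoundLeAt_of_flatInclLe_of_control (by decide) hA hL Dt H ι P haddv hN hK hHN hd4 hP hnt (hKo N W K)
      (fun κ hκ γ _ 𝔭 h𝔭 he hf 𝔭' h𝔭' hne ι' hind ΩK Ωp Q hΩK hΩp hBDP ↦
        (hEq W N K Dt hR hO6 hirr hr hN hK hHN κ hκ γ 𝔭 h𝔭 he hf 𝔭' h𝔭' hne ι' hind ΩK Ωp Q hΩK hΩp hBDP).le)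
      (fun κ hκ γ _ 𝔭 h𝔭 he hf ↦ hCtl N K Dt H ι P hN hK hHN hP hnt (hKo N W K) κ hκ γ 𝔭 h𝔭 he hf)
  · intro N _ K _ _ Dt H ι P hN hK hHN _hodd hd4 _hLt hP hnt
    exact indexUpperBoundLeAt_of_flatInclGe_of_control (by decide) hA hL Dt H ι P haddv hN hK hHN hd4 hP hnt (hKo N W K)
      (fun κ hκ γ _ 𝔭 h𝔭 he hf 𝔭' h𝔭' hne ι' hind ΩK Ωp Q hΩK hΩp hBDP ↦
        (hEq W N K Dt hR hO6 hirr hr hN hK hHN κ hκ γ 𝔭 h𝔭 he hf 𝔭' h𝔭' hne ι' hind ΩK Ωp Q hΩK hΩp hBDP).ge)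
      (fun κ hκ γ _ 𝔭 h𝔭 he hf ↦ hCtl N K Dt H ι P hN hK hHN hP hnt (hKo N W K) κ hκ γ 𝔭 h𝔭 he hf)
  · -- the twist's r = 0 LOWER half: K9's L₀ at `Wd`, a wild row of analytic rank `0`
    intro N _ K _ _ Wd _ _ hN hK hHN hodd _hd4 hC hLt
    obtain ⟨Cd, hCd⟩ := hC
    have hHN' : SatisfiesHeegnerHypothesis (W.conductorNorm ℤ) K := hN ▸ hHN
    obtain ⟨hO6d, -⟩ := classO6_twist_of_heegner W hO6 K hK hHN' hodd Wd Cd hCd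
    have hD0 : (NumberField.discr K : ℚ) ≠ 0 := by exact_mod_cast NumberField.discr_ne_zero K
    haveI : (W.quadraticTwist (NumberField.discr K : ℚ)).IsElliptic := W.isElliptic_quadraticTwist hD0
    have hLd1 : Wd.entireLFunction 1 ≠ 0 := by rw [← hCd, entireLFunction_smul]; exact hLt
    exact hL0 Wd (analyticRank_eq_zero_of_entireLFunction_one_ne_zero Wd hLd1) hO6d
  · -- the twist's r = 0 UPPER half: §2
    intro N _ K _ _ Wd _ _ hN hK hHN hodd _hd4 hC hLt
    exact missingUpperBoundAt_twist_wild_of_coatesSujatha_of_kato hKatoT hKatoA hCM hGZK hmod hCS W hO6 hirr hN K hK hHN hodd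
      Wd hC hLt

end WildThree

end Summit.BirchSwinnertonDyer.BirchSwinnertonDyer.Theorems.UniversalToricDescentWaldspurgerFlat

end
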